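import Summits.QuantumFields.YangMills.Theorems.LuscherReductionTwistedTraceScalingStepActionExact
import HarnessLib

/-!
# The transfer kernel along a near step, VALLEY GRADE: the Gaussian model with the exact row action and errors `o(1/β)` at every action scale `σ → 0`
# (lane A of S-BASE, crux `TwistedTraceScaling` stmt-QuantumFields-20203; C3 VALLEY step sandwich — design note
# `pub/ym-fleet/ym-luscher-20007-p1/COARSE-DESIGN.md` §15)

Lane B's `transferKernel_step_chart_sandwich` (`…StepKernelChart`) with its errors `η₁ = stepErrLo`, `η₂ = stepErrUp` is replaced, for use in the VALLEY
(`S(U) < 2η(β) = 2β^{−q}`, `q < 1/3`), by the same sandwich built on the EXACT action increment (`…StepActionExact`): for `β ≥ 0`, `0 ≤ ρ ≤ 1/30`, `σ < 2`,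
`S(U) ≤ σ`, `|y_e|² ≤ ρ²` on every link, `W = P(y)` the gnomonic-chart step, `w = linkVec W`, `D = D_U = covCurl U`, `F = F(U) = plaqCurv U`, `E = stepActionErr ρ σ
= N_P(1728ρ²√σ + 29376ρ³ + 700569ρ⁴)`:
* ★★ `transferKernel_step_valley_sandwich` —
  `e^{2β|E|} e^{−βΣ|y|²} e^{−(β/2)(2S(U) + 2⟪Dw,F⟫ + ‖Dw‖² + E)} ≤ K_β(U, W·U) ≤ e^{2β|E|} e^{−β(1+ρ²)⁻²Σ|y|²} e^{−(β/2)(2S(U) + 2⟪Dw,F⟫ + (1−σ/2)‖Dw‖² − E)}`;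
* `wilsonAction_sub_norm_plaqCurv_sq_eq` — the row-point excess is explicit and non-negative: `S(U) − ‖F(U)‖² = Σ_p (1 − u₀(hol_p U))² = ¼Σ_p S_p²`;
* ★★ `transferKernel_step_le_model_valley` — the UPPER half in EXACTLY lane B's shape `e^{2β|E|} e^{−b'Σ|y|²} e^{−(β/2)(S(U) + ‖F + Dw‖² − η)}` with the
  valley-grade `η = stepActionErr ρ σ + 150·N_P·σρ²` (the row excess `e^{−(β/2)(S − ‖F‖²)} ≤ 1` dropped, `(σ/2)‖Dw‖² ≤ 150 N_P σρ²`): so lane B's upper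
  chain (`…StepUpperModel` → `…PointwiseSuper`) can be re-run verbatim in the valley with `stepErrLo ↦ stepActionErr + 150N_Pσρ²`, and
  `β·η ≍ N_P(√σ log β + 150σ log β + …) → 0` for `ρ² ≍ log β/β` and any `σ → 0`;
* `model_valley_le_transferKernel_step` — the LOWER half with the exact row excess kept: `e^{2β|E|} e^{−βΣ|y|²} e^{−(β/2)E} e^{−(β/2)(S(U) − ‖F‖²)}
  e^{−(β/2)(S(U) + ‖F + Dw‖²)} ≤ K_β(U, W·U)`.
HONEST FRAMING: fixed-lattice bookkeeping for a stub lane of a child of the CONDITIONAL reduction route (femto rung R2b1); not a gap, not Clay.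
-/

set_option autoImplicit false

noncomputable section

open Real
open scoped Matrix BigOperators RealInnerProductSpace
open Literature.MathematicalPhysics.QuantumFieldTheory
open Literature.MathematicalPhysics.QuantumLattice
open Literature.MathematicalPhysics.QuantumFieldTheory.Balaban1983to89.T4CubeChartGnomonic (gnoPoint gnoPoint_zero)

namespace Summit.QuantumFields.YangMills.Theorems.FemtoTransferGap.TwoLattice.Cov

open Summit.QuantumFields.YangMills.Theorems.FemtoTransferGap
open Summit.QuantumFields.YangMills.Theorems.FemtoTransferGap.TwoLattice
open Summit.QuantumFields.YangMills.Theorems.FemtoTransferGap.TwoLattice.Stiff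
open Summit.QuantumFields.YangMills.Theorems.FemtoTransferGap.TwoLattice.GnChart

variable {L : ℕ} [NeZero L]

section Step

variable {ρ σ : ℝ} (U : GaugeConfig 3 L SU2) (y : Edge 3 L → Fin 3 → ℝ)

/-- ★★ **VALLEY-GRADE KERNEL SANDWICH along a near step.**  For `β ≥ 0`, `0 ≤ ρ ≤ 1/30`, `σ < 2`, `S(U) ≤ σ`, `|y_e|² ≤ ρ²` on every link, `W = P(y)`,
`w = linkVec W`:
`e^{2β|E|} e^{−βΣ|y|²} e^{−(β/2)(2S(U) + 2⟪D_Uw,F(U)⟫ + ‖D_Uw‖² + E)} ≤ K_β(U, W·U) ≤ e^{2β|E|} e^{−β(1+ρ²)⁻²Σ|y|²} e^{−(β/2)(2S(U) + 2⟪D_Uw,F(U)⟫ + (1−σ/2)‖D_Uw‖² − E)}`,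
`E = stepActionErr ρ σ`. [cite: Luscher1983, §3] [cite: SeilerLNP1982, §3] -/
theorem transferKernel_step_valley_sandwich {β : ℝ} (hβ : 0 ≤ β) (hρ0 : 0 ≤ ρ) (hρ : ρ ≤ 1 / 30) (hσ : σ < 2)
    (hS : wilsonAction su2Rep U ≤ σ) (hy : ∀ e, ∑ a, y e a ^ 2 ≤ ρ ^ 2) :
    Real.exp (2 * β) ^ Fintype.card (Edge 3 L) * Real.exp (-(β * ∑ e : Edge 3 L, ∑ a, y e a ^ 2)) *
        Real.exp (-(β / 2) * (2 * wilsonAction su2Rep U +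
          2 * ⟪covCurl U (linkVec L (latPatternChart L (fun _ => false) y)), plaqCurv U⟫ +
          ‖covCurl U (linkVec L (latPatternChart L (fun _ => false) y))‖ ^ 2 + stepActionErr (L := L) ρ σ)) ≤
      transferKernel su2Rep β U (latPatternChart L (fun _ => false) y * U) ∧
    transferKernel su2Rep β U (latPatternChart L (fun _ => false) y * U) ≤
      Real.exp (2 * β) ^ Fintype.card (Edge 3 L) * Real.exp (-(β / (1 + ρ ^ 2) ^ 2 * ∑ e : Edge 3 L, ∑ a, y e a ^ 2)) *
        Real.exp (-(β / 2) * (2 * wilsonAction su2Rep U +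
          2 * ⟪covCurl U (linkVec L (latPatternChart L (fun _ => false) y)), plaqCurv U⟫ +
          (1 - σ / 2) * ‖covCurl U (linkVec L (latPatternChart L (fun _ => false) y))‖ ^ 2 - stepActionErr (L := L) ρ σ)) := by
  set W := latPatternChart L (fun _ => false) y with hW
  have h0 : latPatternChart L (fun _ => false) (0 : Edge 3 L → Fin 3 → ℝ) = 1 := by
    funext e; rw [latPatternChart_false]; exact gnoPoint_zero
  -- kinetic factor
  have hkin := latE_gnomonic_sandwich L hβ (ρ := ρ) 0 y (fun e => by simp; positivity) hy
  rw [h0] at hkin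
  simp only [Pi.zero_apply, zero_sub, even_two, Even.neg_pow] at hkin
  obtain ⟨hk1, hk2⟩ := hkin
  -- magnetic factors, valley grade
  obtain ⟨hs, hw⟩ := chart_step_bounds (L := L) hρ0 hy
  have hlo := wilsonAction_step_ge_valley W U hρ hσ hS hs hw
  have hup := wilsonAction_step_le_valley W U hρ hσ hS hs hw
  rw [transferKernel_mul_left_eq]
  have hβ2 : 0 ≤ β / 2 := by linarith
  constructor
  · refine mul_le_mul hk1 (Real.exp_le_exp.mpr ?_) (Real.exp_pos _).le (latE_pos β _ _).le
    nlinarith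
  · refine mul_le_mul hk2 (Real.exp_le_exp.mpr ?_) (Real.exp_pos _).le (by positivity)
    nlinarith

/-- **The row-point excess is explicit**: `S(U) − ‖F(U)‖² = Σ_p (1 − u₀(hol_p U))²` (`= ¼ Σ_p S_p²`), in particular `≥ 0`. [folklore] -/
theorem wilsonAction_sub_norm_plaqCurv_sq_eq (V : GaugeConfig 3 L SU2) :
    wilsonAction su2Rep V - ‖plaqCurv V‖ ^ 2 = ∑ p : Plaquette 3 L, (1 - scalarPart (hol V p)) ^ 2 := by
  rw [wilsonAction_eq_sum_scalarPart, norm_plaqCurv_sq, ← Finset.sum_sub_distrib]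
  refine Finset.sum_congr rfl fun p _ => ?_
  rw [sum_plaqCurv_sq]; ring

/-- `‖D_U w‖² ≤ 300·N_P·ρ²` for a step with link components `≤ ρ`. [cite: Luscher1983, §3] -/
theorem norm_covCurl_sq_le_of_step (hρ0 : 0 ≤ ρ) (hy : ∀ e, ∑ a, y e a ^ 2 ≤ ρ ^ 2) :
    ‖covCurl U (linkVec L (latPatternChart L (fun _ => false) y))‖ ^ 2 ≤ 300 * (Fintype.card (Plaquette 3 L) : ℝ) * ρ ^ 2 := by
  have h := norm_covCurl_le U hρ0 (w := linkVec L (latPatternChart L (fun _ => false) y))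
    (fun e b => by rw [linkVec_apply]; exact (chart_step_bounds (L := L) hρ0 hy).2 e b)
  have h2 := pow_le_pow_left₀ (norm_nonneg _) h 2
  rw [mul_pow, mul_pow, Real.sq_sqrt (Nat.cast_nonneg _), Fintype.card_prod, Fintype.card_fin] at h2
  push_cast at h2
  linarith

/-- ★★ **UPPER half in lane B's shape** (`…StepKernelChart.transferKernel_step_chart_sandwich` with `stepErrLo ↦ stepActionErr ρ σ + 150·N_P·σρ²`):
`K_β(U, W·U) ≤ e^{2β|E|} e^{−β(1+ρ²)⁻²Σ|y|²} e^{−(β/2)(S(U) + ‖F(U) + D_U w‖² − (stepActionErr ρ σ + 150 N_P σ ρ²))}` — valid at EVERY `σ < 2`, and `β·(…) → 0` for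
`ρ² ≍ log β/β`, `σ → 0`. [cite: Luscher1983, §3] [cite: SeilerLNP1982, §3] -/
theorem transferKernel_step_le_model_valley {β : ℝ} (hβ : 0 ≤ β) (hρ0 : 0 ≤ ρ) (hρ : ρ ≤ 1 / 30) (hσ0 : 0 ≤ σ) (hσ : σ < 2)
    (hS : wilsonAction su2Rep U ≤ σ) (hy : ∀ e, ∑ a, y e a ^ 2 ≤ ρ ^ 2) :
    transferKernel su2Rep β U (latPatternChart L (fun _ => false) y * U) ≤
      Real.exp (2 * β) ^ Fintype.card (Edge 3 L) * Real.exp (-(β / (1 + ρ ^ 2) ^ 2 * ∑ e : Edge 3 L, ∑ a, y e a ^ 2)) *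
        Real.exp (-(β / 2) * (wilsonAction su2Rep U +
          (‖plaqCurv U + covCurl U (linkVec L (latPatternChart L (fun _ => false) y))‖ ^ 2 -
            (stepActionErr (L := L) ρ σ + 150 * (Fintype.card (Plaquette 3 L) : ℝ) * σ * ρ ^ 2)))) := by
  have h := (transferKernel_step_valley_sandwich U y hβ hρ0 hρ hσ hS hy).2
  refine h.trans (mul_le_mul_of_nonneg_left (Real.exp_le_exp.mpr ?_) (by positivity))
  have hsq := valleyModel_eq_completed_square U (linkVec L (latPatternChart L (fun _ => false) y))
  have hex : 0 ≤ wilsonAction su2Rep U - ‖plaqCurv U‖ ^ 2 := by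
    rw [wilsonAction_sub_norm_plaqCurv_sq_eq]; exact Finset.sum_nonneg fun p _ => sq_nonneg _
  have hD := norm_covCurl_sq_le_of_step U y hρ0 hy
  have hβ2 : 0 ≤ β / 2 := by linarith
  have hσD : σ / 2 * ‖covCurl U (linkVec L (latPatternChart L (fun _ => false) y))‖ ^ 2 ≤
      150 * (Fintype.card (Plaquette 3 L) : ℝ) * σ * ρ ^ 2 := by
    have := mul_le_mul_of_nonneg_left hD (by linarith : 0 ≤ σ / 2)
    linarith
  nlinarith

/-- ★ **LOWER half with the exact row excess kept** (valley grade; for lane B's lower chain):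
`e^{2β|E|} e^{−βΣ|y|²} e^{−(β/2)E} e^{−(β/2)(S(U) − ‖F‖²)} e^{−(β/2)(S(U) + ‖F + D_Uw‖²)} ≤ K_β(U, W·U)`. [cite: Luscher1983, §3] [cite: SeilerLNP1982, §3] -/
theorem model_valley_le_transferKernel_step {β : ℝ} (hβ : 0 ≤ β) (hρ0 : 0 ≤ ρ) (hρ : ρ ≤ 1 / 30) (hσ : σ < 2)
    (hS : wilsonAction su2Rep U ≤ σ) (hy : ∀ e, ∑ a, y e a ^ 2 ≤ ρ ^ 2) :
    Real.exp (2 * β) ^ Fintype.card (Edge 3 L) * Real.exp (-(β * ∑ e : Edge 3 L, ∑ a, y e a ^ 2)) *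
        (Real.exp (-(β / 2) * stepActionErr (L := L) ρ σ) * Real.exp (-(β / 2) * (wilsonAction su2Rep U - ‖plaqCurv U‖ ^ 2)) *
          Real.exp (-(β / 2) * (wilsonAction su2Rep U + ‖plaqCurv U + covCurl U (linkVec L (latPatternChart L (fun _ => false) y))‖ ^ 2))) ≤
      transferKernel su2Rep β U (latPatternChart L (fun _ => false) y * U) := by
  have h := (transferKernel_step_valley_sandwich U y hβ hρ0 hρ hσ hS hy).1
  refine le_trans (le_of_eq ?_) h
  rw [← Real.exp_add, ← Real.exp_add]
  congr 1
  rw [Real.exp_eq_exp]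
  have hsq := valleyModel_eq_completed_square U (linkVec L (latPatternChart L (fun _ => false) y))
  linear_combination (β / 2) * hsq

end Step

end Summit.QuantumFields.YangMills.Theorems.FemtoTransferGap.TwoLattice.Cov

end
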